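import Summits.BirchSwinnertonDyer.Rank1Residual.ManinAdditive.OrdinaryRamifiedTwistLaw
import Summits.BirchSwinnertonDyer.Rank1Residual.ManinAdditive.RamifiedTwistFlipCriterion
import Literature.NumberTheory.EllipticCurves.ModularDegreeQuadraticTwistValuation
import HarnessLib

/-!
# Proved edges for the g2 ordinary-detwist leaves of cell `bsd-f2-manin` (E-imc-9 / 9a / 9b)

PROVED implications (no `sorry`, nothing new asserted), after the planner-of-record's scratch
HOME/imc/Sketch-imc-g2.lean v3 (sha16 67903f81d6ef5b7a) — the transport edge re-derived over the LANDED
dictionary `ModularParametrizationData.padicValInt_c_eq_iff_of_quadraticTwist_of_natAbs_eq`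
(`Literature/…/ModularDegreeQuadraticTwistValuation.lean`) instead of the sketch's private copy:

* `ordinaryTwistCommutes_unstarred_of_ordinaryRamifiedTwistLaw` : E-imc-9 ⟹ the commutation clause on the
  unstarred end (`v_p Δ_min < 6`);
* `starred_dvd_modularDegree_of_ordinaryRamifiedTwistLaw` : E-imc-9 ⟹ the STARRED end of a potentially-
  ordinary twist pair has `p ∣ deg φ₀` (the ordinary-cell case of E-imc-10, in pair form);
* `ordinaryTwistCommutes_of_flipCriterion` : E-imc-9b ∧ «the twist keeps the conductor» (the in-print support
  S-imc-9c, taken as an explicit hypothesis) ⟹ E-imc-9a;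
* `padicValInt_maninConstant_eq_of_ordinaryRamifiedTwistLaw` : E-imc-9 ∧ the Tate jump `v_pΔ′ = v_pΔ + 6` ∧
  `aₙ = 0` for `p ∣ n` on both curves ∧ equal conductors ⟹ `v_p(c′) = v_p(c)` and hence
  `p ∤ c ⟹ p ∤ c′` — in a principal-series cell the Manin `p`-unit property needs proving for ONE member
  of each `χ_{p*}`-pair (consumer: AKR crux 20483 `stub_memberManinUnit_ordinary`).
-/

noncomputable section

open scoped MatrixGroups ModularForm

open CongruenceSubgroup WeierstrassCurve
  Literature.NumberTheory.EllipticCurves Literature.NumberTheory.EllipticCurves.ModularForms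

namespace Summit.BirchSwinnertonDyer.Rank1Residual.ManinAdditive

/-- **E-imc-9 ⟹ commutation on the unstarred end.** -/
theorem ordinaryTwistCommutes_unstarred_of_ordinaryRamifiedTwistLaw (p : ℕ)
    (h : OrdinaryRamifiedTwistLaw p) :
    ∀ (W W' : WeierstrassCurve ℚ) [W.IsElliptic] [W.IsGloballyMinimal] [W'.IsElliptic]
      [W'.IsGloballyMinimal] [NeZero (W.conductorNorm ℤ)] [NeZero (W'.conductorNorm ℤ)]
      (D : ModularParametrizationData W (W.conductorNorm ℤ)) (C : WeierstrassCurve.VariableChange ℚ),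
      p.Prime → 5 ≤ p → p ^ 2 ∣ W.conductorNorm ℤ →
      W.HasPotentiallyGoodOrdinaryReductionAtPrime p →
      padicValInt p W.minimalDiscriminantInt < 6 →
      (∀ z ∈ D.L.lattice, ∃ w ∈ periodLattice D.f, z = D.c * w) →
      C • W.quadraticTwist ((((-1 : ℤ) ^ (p / 2) * p : ℤ) : ℚ)) = W' →
      ∃ D' : ModularParametrizationData W' (W'.conductorNorm ℤ),
        ∀ z ∈ D'.L.lattice, ∃ w ∈ periodLattice D'.f, z = D'.c * w := by
  intro W W' _ _ _ _ _ _ D C hp hp5 hN hord hv hD hW'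
  exact (h W W' D C hp hp5 hN hord hv hD hW').1

/-- **E-imc-9 ⟹ the starred end has `p ∣ deg φ₀`** (ordinary-cell case of E-imc-10, pair form). -/
theorem starred_dvd_modularDegree_of_ordinaryRamifiedTwistLaw (p : ℕ) (h : OrdinaryRamifiedTwistLaw p) :
    ∀ (W W' : WeierstrassCurve ℚ) [W.IsElliptic] [W.IsGloballyMinimal] [W'.IsElliptic]
      [W'.IsGloballyMinimal] [NeZero (W.conductorNorm ℤ)] [NeZero (W'.conductorNorm ℤ)]
      (D : ModularParametrizationData W (W.conductorNorm ℤ))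
      (D' : ModularParametrizationData W' (W'.conductorNorm ℤ)) (C : WeierstrassCurve.VariableChange ℚ),
      p.Prime → 5 ≤ p → p ^ 2 ∣ W.conductorNorm ℤ →
      W.HasPotentiallyGoodOrdinaryReductionAtPrime p →
      padicValInt p W.minimalDiscriminantInt < 6 →
      (∀ z ∈ D.L.lattice, ∃ w ∈ periodLattice D.f, z = D.c * w) →
      C • W.quadraticTwist ((((-1 : ℤ) ^ (p / 2) * p : ℤ) : ℚ)) = W' →
      (∀ z ∈ D'.L.lattice, ∃ w ∈ periodLattice D'.f, z = D'.c * w) → p ∣ D'.modularDegree := by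
  intro W W' _ _ _ _ _ _ D D' C hp hp5 hN hord hv hD hW' hD'
  rw [(h W W' D C hp hp5 hN hord hv hD hW').2 D' hD']
  exact dvd_mul_right p _

/-- **E-imc-9b ∧ (twist keeps the conductor) ⟹ E-imc-9a.** The conductor clause (S-imc-9c of the memo: in
tame potentially-good cells with `e ≥ 3` at `p ≥ 5` the `χ_{p*}`-twist has the same conductor) is in print
and enters as the explicit hypothesis `hc`. -/
theorem ordinaryTwistCommutes_of_flipCriterion (p : ℕ) (h : RamifiedTwistFlipCriterion p)
    (hc : ∀ (W W' : WeierstrassCurve ℚ) [W.IsElliptic] [W.IsGloballyMinimal] [W'.IsElliptic]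
      [W'.IsGloballyMinimal] (C : WeierstrassCurve.VariableChange ℚ),
      p.Prime → 5 ≤ p → p ^ 2 ∣ W.conductorNorm ℤ →
      W.HasPotentiallyGoodOrdinaryReductionAtPrime p →
      padicValInt p W.minimalDiscriminantInt ≠ 6 →
      C • W.quadraticTwist ((((-1 : ℤ) ^ (p / 2) * p : ℤ) : ℚ)) = W' →
      W'.conductorNorm ℤ = W.conductorNorm ℤ) :
    OrdinaryTwistCommutes p := by
  intro W W' _ _ _ _ _ _ D C hp hp5 hN hord hv hD hW'
  exact (h W W' D C hp hp5 hN hD hW' (hc W W' C hp hp5 hN hord hv hW')).mpr (Or.inl hord)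

/-! ### Transport of the Manin `p`-adic valuation along an ordinary ramified twist -/

/-- Transport of parametrisation data along an equality of levels (plumbing; the `NeZero` instance
travels too). -/
def castLevel {W : WeierstrassCurve ℚ} {N M : ℕ} [NeZero N] [NeZero M] (h : N = M)
    (D : ModularParametrizationData W N) : ModularParametrizationData W M := by
  subst h
  exact D

/-- `castLevel` does not change the Manin constant. -/
@[simp] theorem maninConstant_castLevel {W : WeierstrassCurve ℚ} {N M : ℕ} [NeZero N] [NeZero M]
    (h : N = M) (D : ModularParametrizationData W N) : (castLevel h D).maninConstant = D.maninConstant := by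
  subst h
  rfl

/-- `castLevel` does not change the modular degree. -/
@[simp] theorem modularDegree_castLevel {W : WeierstrassCurve ℚ} {N M : ℕ} [NeZero N] [NeZero M]
    (h : N = M) (D : ModularParametrizationData W N) : (castLevel h D).modularDegree = D.modularDegree := by
  subst h
  rfl

/-- `castLevel` does not change the lattice. -/
@[simp] theorem L_castLevel {W : WeierstrassCurve ℚ} {N M : ℕ} [NeZero N] [NeZero M]
    (h : N = M) (D : ModularParametrizationData W N) : (castLevel h D).L = D.L := by
  subst h
  rfl

/-- **TRANSPORT EDGE: E-imc-9 ⟹ equal Manin `p`-adic valuations at both ends of a potentially-ordinary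
ramified twist pair of optimal curves** (`p ≥ 5`; given the Tate jump `v_pΔ′_min = v_pΔ_min + 6`, the
vanishing `aₙ = 0` for `p ∣ n` on both curves — automatic from `p² ∣ N` — and equal conductors), hence
`p ∤ c(D) ⟹ p ∤ c(D′)`. Proof: the degree law `deg′ = p·deg` of E-imc-9 fed into the landed Watkins
dictionary `padicValInt_c_eq_iff_of_quadraticTwist_of_natAbs_eq`. -/
theorem padicValInt_maninConstant_eq_of_ordinaryRamifiedTwistLaw (p : ℕ) [Fact p.Prime]
    (h : OrdinaryRamifiedTwistLaw p) :
    ∀ (W W' : WeierstrassCurve ℚ) [W.IsElliptic] [W.IsGloballyMinimal] [W'.IsElliptic]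
      [W'.IsGloballyMinimal] [NeZero (W.conductorNorm ℤ)] [NeZero (W'.conductorNorm ℤ)]
      (D : ModularParametrizationData W (W.conductorNorm ℤ))
      (D' : ModularParametrizationData W' (W'.conductorNorm ℤ)) (C : WeierstrassCurve.VariableChange ℚ),
      5 ≤ p → p ^ 2 ∣ W.conductorNorm ℤ →
      W.HasPotentiallyGoodOrdinaryReductionAtPrime p →
      padicValInt p W.minimalDiscriminantInt < 6 →
      (∀ z ∈ D.L.lattice, ∃ w ∈ periodLattice D.f, z = D.c * w) →
      C • W.quadraticTwist ((((-1 : ℤ) ^ (p / 2) * p : ℤ) : ℚ)) = W' →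
      (∀ z ∈ D'.L.lattice, ∃ w ∈ periodLattice D'.f, z = D'.c * w) →
      W'.conductorNorm ℤ = W.conductorNorm ℤ →
      (∀ n : ℕ, p ∣ n → W.LFunction n = 0) → (∀ n : ℕ, p ∣ n → W'.LFunction n = 0) →
      padicValInt p W'.minimalDiscriminantInt = padicValInt p W.minimalDiscriminantInt + 6 →
      padicValInt p D'.maninConstant = padicValInt p D.maninConstant ∧
        (¬ (p : ℤ) ∣ D.maninConstant → ¬ (p : ℤ) ∣ D'.maninConstant) := by
  intro W W' _ _ _ _ _ _ D D' C hp5 hN hord hv hD hW' hD' hNN hW0 hW'0 hjump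
  have hp : p.Prime := Fact.out
  have hp2 : p ≠ 2 := by omega
  -- the naive twist and its vanishing coefficients at the multiples of `p`
  set d : ℚ := (((-1 : ℤ) ^ (p / 2) * p : ℤ) : ℚ) with hd
  have hd0 : d ≠ 0 := by
    rw [hd]
    push_cast
    exact mul_ne_zero (pow_ne_zero _ (by norm_num)) (by exact_mod_cast hp.ne_zero)
  haveI : (W.quadraticTwist d).IsElliptic := W.isElliptic_quadraticTwist hd0
  have hT0 : ∀ n : ℕ, p ∣ n → (W.quadraticTwist d).LFunction n = 0 := by
    intro n hn
    have e := hW'0 n hn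
    rw [← hW', WeierstrassCurve.LFunction_smul] at e
    exact e
  have habs : ∀ n : ℕ, (W'.LFunction n).natAbs = (W.LFunction n).natAbs := by
    intro n
    rw [← hW', WeierstrassCurve.LFunction_smul]
    exact W.natAbs_LFunction_quadraticTwist_pStar_eq_of_apply_eq_zero hp2 hW0 hT0 n
  -- degree law from E-imc-9, moved to the common level
  have hdeg : D'.modularDegree = p * D.modularDegree := (h W W' D C hp hp5 hN hord hv hD hW').2 D' hD'
  have hdeg'' : (castLevel hNN D').modularDegree = p * D.modularDegree := by
    rw [modularDegree_castLevel, hdeg]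
  -- the landed dictionary at the common level `W.conductorNorm ℤ`
  have key := ModularParametrizationData.padicValInt_c_eq_iff_of_quadraticTwist_of_natAbs_eq p d hd0 C
    hW' habs D (castLevel hNN D')
  rw [maninConstant_castLevel, modularDegree_castLevel] at key
  have hd0' : D.modularDegree ≠ 0 := D.deg_pos.ne'
  have hv' : padicValInt p D'.maninConstant = padicValInt p D.maninConstant := by
    refine key.mpr ?_
    rw [hdeg, hjump, padicValNat.mul hp.ne_zero hd0', padicValNat_self]
    omega
  refine ⟨hv', fun hc hdvd => ?_⟩
  have h0 : padicValInt p D.maninConstant = 0 := padicValInt.eq_zero_of_not_dvd hc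
  have hc'0 : D'.maninConstant ≠ 0 := D'.maninConstant_ne_zero_holds
  have h1 : 1 ≤ padicValInt p D'.maninConstant := by
    rcases (padicValInt_dvd_iff (p := p) 1 D'.maninConstant).mp (by simpa using hdvd) with h' | h'
    · exact absurd h' hc'0
    · exact h'
  omega

end Summit.BirchSwinnertonDyer.Rank1Residual.ManinAdditive

end
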